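import Summits.CriticalPhenomena.PercolationContinuityZ3.Theorems.Transplant.SkelPhiParaLocChain
import Summits.CriticalPhenomena.PercolationContinuityZ3.Theorems.Transplant.SkelPhiParaCoarseV
import Summits.CriticalPhenomena.PercolationContinuityZ3.Theorems.Transplant.KNParaChainSchedN
import HarnessLib

/-!
# N1 (the `{±1}` node), LEVEL 1, (C) column file (C-N9): THE SIGNED BANDS OF THE (C) CORRIDOR READ IN THE RUN FRAME `runX φ c₀ n h 1` — graph-side
# route data of phase 3: the x-band (`B = xPrmW n ℓ h R′ q N` along axis `0`, band SIGN `σB = ±1` = the corridor's direction, every stride of physical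
# sign `σB`) and the y′-band (`B = yPrmX n ℓ h v R′ q N` along axis `1 = ⌊β′/U⌋` with sign `σB`, transverse `α` exact with drift `v`): for each,
# **link ⊆ region** (`w ∈ pgramPrism t n h (3ℓ) R ⇒ runX w ∈ B.pregion aB σB 0 k`) and **steered piece ⊆ next core** (`w ∈` the side half / top piece
# of sign `σB` and piece `τ` matched to `B.steer` `⇒ runX w ∈ B.pcore aB σB 0 (k+1)`), from a seed `t` whose reading lies in the `R′`-enlarged core `k` —
# the inputs of p1's graph-side route datum (N-K6) for the band steps of `corrRunSchedS` (C-N5b), in ONE frame for both directions (no frame sign, so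
# the u-rounds' readings of `SkelPhiParaLocChain` and the frame change of `SkelPhiParaFrameChangeFine` apply unchanged).

builds on p205010 (kernel theorem, internal audit signed; external expert review pending) — nothing in this file uses p205010; nothing here is a
claim about the open node `SamePDropOfSkeletonNeg`.
Lane `prim-bschramm`, seat `prim-bschramm-p5` (gen 8; (C) lineage); helper file (`--supports stmt-CriticalPhenomena-4575`).
[cite: MartineauTassion2017, §3.2 Lemma 3.5, §4.3 Lemma 4.2] [cite: KozmaNitzan2024, §4 Lemma 11 (pp. 22–23), Lemma 12 (pp. 23–25)]
-/

noncomputable section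

namespace Summit.CriticalPhenomena.PercolationContinuityZ3.Theorems.Transplant

namespace Skelφ

open Literature.Probability.Percolation Literature.Probability.LatticeModels SimpleGraph
open Literature.Probability.Percolation.KozmaNitzan.Cells (oth)
open ChainPlanar ChainPara

variable {V : Type} {G : SimpleGraph V} {φ : V → Site 2}

/-- `oth 0 = 1` on `Fin 2`. [folklore] -/
private theorem oth_zero' : oth (0 : Fin 2) = 1 := by decide

/-- `oth 1 = 0` on `Fin 2`. [folklore] -/
private theorem oth_one' : oth (1 : Fin 2) = 0 := by decide

/-- Membership in the `R′`-enlarged core `k` of a signed run schedule = signed run-coordinate membership in the enlarged core. [folklore] -/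
theorem mem_runSched_enl_iff {P : RunPrm} (a : Fin 2) {σ : ℤ} (hσ : σ = 1 ∨ σ = -1) (c : Site 2) (hP : RunOK P) (heb : P.eb = P.ea) {k : ℕ} {y : Site 2} :
    y ∈ Finset.Icc ((P.scheduleN a hσ c hP heb).lo k - (((P.scheduleN a hσ c hP heb).R' : ℕ) : Site 2))
        ((P.scheduleN a hσ c hP heb).hi k + (((P.scheduleN a hσ c hP heb).R' : ℕ) : Site 2)) ↔
      P.InEnl k (σ * (y a - c a)) (σ * (y (oth a) - c (oth a))) := by
  show y ∈ Finset.Icc (dLo a σ c (P.aLo k) (P.aHi k) (P.bLo k) (P.bHi k) - ((P.ea : ℕ) : Site 2))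
      (dHi a σ c (P.aLo k) (P.aHi k) (P.bLo k) (P.bHi k) + ((P.ea : ℕ) : Site 2)) ↔ _
  rw [dBox_enlarge hσ, RunPrm.mem_enlarge_iff hσ heb]

/-! ## §1 The signed x-band in the run frame of sign `1` -/

section XBand

variable {n ℓ : ℕ} (hn : 1 ≤ n) (c₀ : V) (h : ℤ) {σB : ℤ} (hσB : σB = 1 ∨ σB = -1) (R' q N : ℕ)
include hn

/-- **Link ⊆ region, signed x-band**: `runX t` in the `R′`-enlarged core `k` of `(xPrmW …).scheduleN 0 σB 0` and `w ∈ pgramPrism t n h (3ℓ) R` give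
`runX w ∈ region k`. [cite: KozmaNitzan2024, §4 Lemma 11 (p. 22)] -/
theorem runX_mem_xbandRegion_of_link {k : ℕ} {t w : V} {R : ℕ}
    (ht : runX φ c₀ n h 1 t ∈ Finset.Icc (((xPrmW n ℓ h R' q N).scheduleN 0 hσB 0 (xPrmW_ok n ℓ h R' q N) (xPrmW_eb n ℓ h R' q N)).lo k -
        ((((xPrmW n ℓ h R' q N).scheduleN 0 hσB 0 (xPrmW_ok n ℓ h R' q N) (xPrmW_eb n ℓ h R' q N)).R' : ℕ) : Site 2))
      (((xPrmW n ℓ h R' q N).scheduleN 0 hσB 0 (xPrmW_ok n ℓ h R' q N) (xPrmW_eb n ℓ h R' q N)).hi k +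
        ((((xPrmW n ℓ h R' q N).scheduleN 0 hσB 0 (xPrmW_ok n ℓ h R' q N) (xPrmW_eb n ℓ h R' q N)).R' : ℕ) : Site 2)))
    (hw : w ∈ pgramPrism G φ t n h (3 * ℓ) R) :
    runX φ c₀ n h 1 w ∈ ((xPrmW n ℓ h R' q N).scheduleN 0 hσB 0 (xPrmW_ok n ℓ h R' q N) (xPrmW_eb n ℓ h R' q N)).region k := by
  have ht' := (mem_runSched_enl_iff 0 hσB 0 (xPrmW_ok n ℓ h R' q N) (xPrmW_eb n ℓ h R' q N)).1 ht
  obtain ⟨h0, h1⟩ := link_runX hn c₀ h (Or.inl rfl) hw R' q N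
  have hσ1 : |σB| = 1 := by rcases hσB with rfl | rfl <;> simp
  rw [RunPrm.scheduleN_region, RunPrm.mem_pregion_iff hσB]
  simp only [Pi.zero_apply, sub_zero, oth_zero'] at ht' ⊢
  refine RunPrm.inRegion_of_link ht' ?_ ?_
  · rw [← mul_sub, abs_mul, hσ1, one_mul]; exact h0
  · rw [← mul_sub, abs_mul, hσ1, one_mul]; exact h1

/-- **Steered side half ⊆ next core, signed x-band**: every stride has physical sign `σB`; with `τₖ := steer k (σB·runX t 1)`, every
`w ∈ pgSideHalfW t n h ℓ R σB (σB·τₖ)` has `runX w ∈ core (k+1)`. [cite: MartineauTassion2017, §4.3 Lemma 4.2] [cite: KozmaNitzan2024, §4 Lemma 12] -/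
theorem runX_mem_xbandCore_succ_of_piece [G.LocallyFinite] {k : ℕ} {t w : V} {R : ℕ}
    (ht : runX φ c₀ n h 1 t ∈ Finset.Icc (((xPrmW n ℓ h R' q N).scheduleN 0 hσB 0 (xPrmW_ok n ℓ h R' q N) (xPrmW_eb n ℓ h R' q N)).lo k -
        ((((xPrmW n ℓ h R' q N).scheduleN 0 hσB 0 (xPrmW_ok n ℓ h R' q N) (xPrmW_eb n ℓ h R' q N)).R' : ℕ) : Site 2))
      (((xPrmW n ℓ h R' q N).scheduleN 0 hσB 0 (xPrmW_ok n ℓ h R' q N) (xPrmW_eb n ℓ h R' q N)).hi k +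
        ((((xPrmW n ℓ h R' q N).scheduleN 0 hσB 0 (xPrmW_ok n ℓ h R' q N) (xPrmW_eb n ℓ h R' q N)).R' : ℕ) : Site 2)))
    (hw : w ∈ pgSideHalfW G φ t n h ℓ R σB (σB * (xPrmW n ℓ h R' q N).steer k (σB * runX φ c₀ n h 1 t 1))) :
    runX φ c₀ n h 1 w ∈ ((xPrmW n ℓ h R' q N).scheduleN 0 hσB 0 (xPrmW_ok n ℓ h R' q N) (xPrmW_eb n ℓ h R' q N)).core (k + 1) := by
  set τ₀ := (xPrmW n ℓ h R' q N).steer k (σB * runX φ c₀ n h 1 t 1) with hτ₀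
  have hτ₀' : τ₀ = 1 ∨ τ₀ = -1 := (xPrmW n ℓ h R' q N).steer_eq_or k _
  have hστ : σB * τ₀ = 1 ∨ σB * τ₀ = -1 := by rcases hσB with rfl | rfl <;> rcases hτ₀' with h1 | h1 <;> simp [h1]
  have hσσ : σB * σB = 1 := by rcases hσB with h1 | h1 <;> simp [h1]
  have ht' := (mem_runSched_enl_iff 0 hσB 0 (xPrmW_ok n ℓ h R' q N) (xPrmW_eb n ℓ h R' q N)).1 ht
  simp only [Pi.zero_apply, sub_zero, oth_zero'] at ht'
  obtain ⟨h0, hpc⟩ := landing_runX_W_signed (φ := φ) hn c₀ h hσB hστ hw R' (n * ℓ / shearUnit n h + 1) q N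
  have e : σB * (σB * τ₀) = τ₀ := by rw [← mul_assoc, hσσ, one_mul]
  rw [e] at hpc
  have hpiece : (xPrmW n ℓ h R' q N).InPiece τ₀ (σB * runX φ c₀ n h 1 w 1 - σB * runX φ c₀ n h 1 t 1 - (xPrmW n ℓ h R' q N).d) := by
    have hd : (xPrmW n ℓ h R' q N).d = 0 := rfl
    rw [hd, sub_zero, ← mul_sub]
    exact hpc
  rw [RunPrm.scheduleN_core, RunPrm.mem_pcore_iff hσB]
  simp only [Pi.zero_apply, sub_zero, oth_zero']
  refine RunPrm.inCore_succ_of_landing (xPrmW_ok n ℓ h R' q N) ht' ?_ ?_ hpiece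
  · show ((xPrmW n ℓ h R' q N).sLo : ℤ) ≤ σB * runX φ c₀ n h 1 w 0 - σB * runX φ c₀ n h 1 t 0
    rw [← mul_sub, h0]; exact le_rfl
  · show σB * runX φ c₀ n h 1 w 0 - σB * runX φ c₀ n h 1 t 0 ≤ (xPrmW n ℓ h R' q N).sHi
    rw [← mul_sub, h0]; exact le_rfl

end XBand

/-! ## §2 The signed y′-band in the run frame of sign `1` (along axis `1 = ⌊β′/U⌋`) -/

/-- **y′-band parameters read in `runX … 1` along axis `1` with a band sign**: as p1's `yPrmW` but `sLo` one lower (the floor of the along reading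
is taken BEFORE the sign, so a `−v` stride may read one unit short). [cite: MartineauTassion2017, §3.2 Lemma 3.5 (L(v,b), L(−a,v)), §4.3 Lemma 4.2] -/
def yPrmX (n ℓ : ℕ) (h v : ℤ) (R' q N : ℕ) : ChainPara.RunPrm where
  sLo := ((n : ℤ) * ℓ - (shearUnit n h : ℕ) + 1) / (shearUnit n h : ℕ) - 1
  sHi := (n : ℤ) * ℓ / (shearUnit n h : ℕ) + 1
  d := v
  Pp := (n - v).toNat
  Pm := (n + v).toNat
  Wp := (n - v).toNat
  Wm := (n + v).toNat
  ea := R'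
  eb := R'
  La := 3 * (n * ℓ) / shearUnit n h + 1
  Lb := n
  q := q
  N := N

/-- The signed y′-band parameters are admissible (`1 ≤ n`, `|v| ≤ n`, two layers: `2(n + |h|) ≤ nℓ + 1`). [folklore] -/
theorem yPrmX_ok {n ℓ : ℕ} {h v : ℤ} (hn : 1 ≤ n) (hv : |v| ≤ n) (hlay : 2 * ((n + h.natAbs : ℕ) : ℤ) ≤ (n : ℤ) * ℓ + 1) (R' q N : ℕ) :
    ChainPara.RunOK (yPrmX n ℓ h v R' q N) where
  hs0 := by
    simp only [yPrmX]
    have hc : (0 : ℤ) < (shearUnit n h : ℕ) := shearUnit_pos hn h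
    have h1 : (1 : ℤ) ≤ ((n : ℤ) * ℓ - (shearUnit n h : ℕ) + 1) / (shearUnit n h : ℕ) := by
      rw [Int.le_ediv_iff_mul_le hc]
      unfold shearUnit; push_cast at hlay ⊢; linarith
    linarith
  hs := by
    simp only [yPrmX]
    have hc : (0 : ℤ) < (shearUnit n h : ℕ) := shearUnit_pos hn h
    have h1 : ((n : ℤ) * ℓ - (shearUnit n h : ℕ) + 1) / (shearUnit n h : ℕ) ≤ (n : ℤ) * ℓ / (shearUnit n h : ℕ) :=
      Int.ediv_le_ediv hc (by linarith)
    linarith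
  hsL := by
    simp only [yPrmX]
    push_cast
    have hc : (0 : ℤ) < (shearUnit n h : ℕ) := shearUnit_pos hn h
    have h1 : (n : ℤ) * ℓ / (shearUnit n h : ℕ) ≤ 3 * ((n : ℤ) * ℓ) / (shearUnit n h : ℕ) :=
      Int.ediv_le_ediv hc (by linarith [show (0 : ℤ) ≤ (n : ℤ) * ℓ by positivity])
    linarith
  hd := by simp only [yPrmX]; exact_mod_cast hv
  hPm := le_rfl
  hPp := le_rfl

/-- `eb = ea` for the signed y′-band parameters. [folklore] -/
theorem yPrmX_eb (n ℓ : ℕ) (h v : ℤ) (R' q N : ℕ) : (yPrmX n ℓ h v R' q N).eb = (yPrmX n ℓ h v R' q N).ea := rfl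

section YBand

variable {n ℓ : ℕ} {h v : ℤ} (hn : 1 ≤ n) (hv : |v| ≤ n) (hlay : 2 * ((n + h.natAbs : ℕ) : ℤ) ≤ (n : ℤ) * ℓ + 1) (c₀ : V)
  {σB : ℤ} (hσB : σB = 1 ∨ σB = -1) (R' q N : ℕ)
include hn

/-- **Link ⊆ region, signed y′-band**: `runX t` in the `R′`-enlarged core `k` of `(yPrmX …).scheduleN 1 σB 0` and `w ∈ pgramPrism t n h (3ℓ) R` give
`runX w ∈ region k`. [cite: KozmaNitzan2024, §4 Lemma 11 (p. 22)] -/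
theorem runX_mem_ybandRegion_of_link {k : ℕ} {t w : V} {R : ℕ}
    (ht : runX φ c₀ n h 1 t ∈ Finset.Icc (((yPrmX n ℓ h v R' q N).scheduleN 1 hσB 0 (yPrmX_ok hn hv hlay R' q N) (yPrmX_eb n ℓ h v R' q N)).lo k -
        ((((yPrmX n ℓ h v R' q N).scheduleN 1 hσB 0 (yPrmX_ok hn hv hlay R' q N) (yPrmX_eb n ℓ h v R' q N)).R' : ℕ) : Site 2))
      (((yPrmX n ℓ h v R' q N).scheduleN 1 hσB 0 (yPrmX_ok hn hv hlay R' q N) (yPrmX_eb n ℓ h v R' q N)).hi k +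
        ((((yPrmX n ℓ h v R' q N).scheduleN 1 hσB 0 (yPrmX_ok hn hv hlay R' q N) (yPrmX_eb n ℓ h v R' q N)).R' : ℕ) : Site 2)))
    (hw : w ∈ pgramPrism G φ t n h (3 * ℓ) R) :
    runX φ c₀ n h 1 w ∈ ((yPrmX n ℓ h v R' q N).scheduleN 1 hσB 0 (yPrmX_ok hn hv hlay R' q N) (yPrmX_eb n ℓ h v R' q N)).region k := by
  have ht' := (mem_runSched_enl_iff 1 hσB 0 (yPrmX_ok hn hv hlay R' q N) (yPrmX_eb n ℓ h v R' q N)).1 ht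
  -- the link readings of `link_runX` (x-record's numbers `La = n`, `Lb = 3nℓ/U + 1`) are the y-record's `Lb`, `La`
  obtain ⟨h0, h1⟩ := link_runX hn c₀ h (Or.inl rfl) hw R' q N
  have hσ1 : |σB| = 1 := by rcases hσB with rfl | rfl <;> simp
  rw [RunPrm.scheduleN_region, RunPrm.mem_pregion_iff hσB]
  simp only [Pi.zero_apply, sub_zero, oth_one'] at ht' ⊢
  refine RunPrm.inRegion_of_link ht' ?_ ?_
  · rw [← mul_sub, abs_mul, hσ1, one_mul]; exact h1
  · rw [← mul_sub, abs_mul, hσ1, one_mul]; exact h0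

/-- **Steered top piece ⊆ next core, signed y′-band**: every stride has physical sign `σB`; with `τₖ := steer k (σB·runX t 0)` (the drifted window's
steering sign at the seed's exact `α`), every `w ∈ pgTopPieceW t n h ℓ R σB τₖ v` has `runX w ∈ core (k+1)`.
[cite: MartineauTassion2017, §4.3 Lemma 4.2] [cite: KozmaNitzan2024, §4 Lemma 12 (pp. 23–25)] -/
theorem runX_mem_ybandCore_succ_of_piece [G.LocallyFinite] {k : ℕ} {t w : V} {R : ℕ}
    (ht : runX φ c₀ n h 1 t ∈ Finset.Icc (((yPrmX n ℓ h v R' q N).scheduleN 1 hσB 0 (yPrmX_ok hn hv hlay R' q N) (yPrmX_eb n ℓ h v R' q N)).lo k -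
        ((((yPrmX n ℓ h v R' q N).scheduleN 1 hσB 0 (yPrmX_ok hn hv hlay R' q N) (yPrmX_eb n ℓ h v R' q N)).R' : ℕ) : Site 2))
      (((yPrmX n ℓ h v R' q N).scheduleN 1 hσB 0 (yPrmX_ok hn hv hlay R' q N) (yPrmX_eb n ℓ h v R' q N)).hi k +
        ((((yPrmX n ℓ h v R' q N).scheduleN 1 hσB 0 (yPrmX_ok hn hv hlay R' q N) (yPrmX_eb n ℓ h v R' q N)).R' : ℕ) : Site 2)))
    (hw : w ∈ pgTopPieceW G φ t n h ℓ R σB ((yPrmX n ℓ h v R' q N).steer k (σB * runX φ c₀ n h 1 t 0)) v) :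
    runX φ c₀ n h 1 w ∈ ((yPrmX n ℓ h v R' q N).scheduleN 1 hσB 0 (yPrmX_ok hn hv hlay R' q N) (yPrmX_eb n ℓ h v R' q N)).core (k + 1) := by
  set τ₀ := (yPrmX n ℓ h v R' q N).steer k (σB * runX φ c₀ n h 1 t 0) with hτ₀
  have hτ₀' : τ₀ = 1 ∨ τ₀ = -1 := (yPrmX n ℓ h v R' q N).steer_eq_or k _
  have hc : (0 : ℤ) < (shearUnit n h : ℕ) := shearUnit_pos hn h
  have hc' : 0 < (shearUnit n h : ℤ) := shearUnit_pos hn h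
  have ht' := (mem_runSched_enl_iff 1 hσB 0 (yPrmX_ok hn hv hlay R' q N) (yPrmX_eb n ℓ h v R' q N)).1 ht
  simp only [Pi.zero_apply, sub_zero, oth_one'] at ht'
  obtain ⟨hb1, hb2, -, hp1, hm1⟩ := topPieceW_run_bounds hσB hw
  -- along: the floored `β′` reading, both signs
  have hsLo : (yPrmX n ℓ h v R' q N).sLo = ((n : ℤ) * ℓ - (shearUnit n h : ℕ) + 1) / (shearUnit n h : ℕ) - 1 := rfl
  have hsHi : (yPrmX n ℓ h v R' q N).sHi = (n : ℤ) * ℓ / (shearUnit n h : ℕ) + 1 := rfl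
  have halong : (yPrmX n ℓ h v R' q N).sLo ≤ σB * (runX φ c₀ n h 1 w 1 - runX φ c₀ n h 1 t 1) ∧
      σB * (runX φ c₀ n h 1 w 1 - runX φ c₀ n h 1 t 1) ≤ (yPrmX n ℓ h v R' q N).sHi := by
    rw [hsLo, hsHi]
    have hU : ((shearUnit n h : ℕ) : ℤ) = ((n + h.natAbs : ℕ) : ℤ) := rfl
    rw [hU]
    rcases hσB with hs | hs <;> rw [hs] at hb1 hb2 ⊢
    · rw [one_mul] at hb1 hb2
      obtain ⟨hl, hu⟩ := runX_sub_runX_one_bounds hn φ c₀ h 1 t w (a := (n : ℤ) * ℓ - (n + h.natAbs : ℕ) + 1) (b := (n : ℤ) * ℓ)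
        (by rw [one_mul]; exact hb1) (by rw [one_mul]; exact hb2)
      rw [hU] at hl hu
      constructor <;> linarith
    · have hb1' : -((n : ℤ) * ℓ) ≤ 1 * shearCoord φ t n h w := by linarith
      have hb2' : 1 * shearCoord φ t n h w ≤ -((n : ℤ) * ℓ - (n + h.natAbs : ℕ) + 1) := by linarith
      obtain ⟨hl, hu⟩ := runX_sub_runX_one_bounds hn φ c₀ h 1 t w hb1' hb2'
      have hnb := neg_ediv_neg_bounds ((n : ℤ) * ℓ) hc'
      have hna := neg_ediv_neg_bounds ((n : ℤ) * ℓ - (n + h.natAbs : ℕ) + 1) hc'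
      rw [hU] at hl hu hnb hna
      constructor <;> linarith
  -- transverse: `σB·Δα − v` in the exact piece of sign `τ₀`
  have h0 : runX φ c₀ n h 1 w 0 - runX φ c₀ n h 1 t 0 = relCoord φ t 0 w := by rw [runX_sub_runX_zero, one_mul]
  have hpiece : (yPrmX n ℓ h v R' q N).InPiece τ₀ (σB * runX φ c₀ n h 1 w 0 - σB * runX φ c₀ n h 1 t 0 - (yPrmX n ℓ h v R' q N).d) := by
    have hd : (yPrmX n ℓ h v R' q N).d = v := rfl
    have hPp : ((yPrmX n ℓ h v R' q N).Pp : ℤ) = n - v := by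
      show (((n - v).toNat : ℕ) : ℤ) = n - v; rw [Int.toNat_of_nonneg (by linarith [(abs_le.1 hv).2])]
    have hPm : ((yPrmX n ℓ h v R' q N).Pm : ℤ) = n + v := by
      show (((n + v).toNat : ℕ) : ℤ) = n + v; rw [Int.toNat_of_nonneg (by linarith [(abs_le.1 hv).1])]
    rw [hd, ← mul_sub, h0, ChainPara.RunPrm.InPiece, hPp, hPm]
    have hαn : |relCoord φ t 0 w| ≤ n := ((mem_pgramCyl (φ := φ)).1 ((mem_pgTopPieceW G φ).1 hw).2.1).1
    have hσα : σB * relCoord φ t 0 w ≤ n := by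
      rcases hσB with hs | hs <;> rw [hs] <;> [linarith [(abs_le.1 hαn).2]; linarith [(abs_le.1 hαn).1]]
    have hσα' : -(n : ℤ) ≤ σB * relCoord φ t 0 w := by
      rcases hσB with hs | hs <;> rw [hs] <;> [linarith [(abs_le.1 hαn).1]; linarith [(abs_le.1 hαn).2]]
    constructor
    · intro h1; have := hp1 h1; constructor <;> linarith
    · intro h1; have := hm1 h1; constructor <;> linarith
  rw [RunPrm.scheduleN_core, RunPrm.mem_pcore_iff hσB]
  simp only [Pi.zero_apply, sub_zero, oth_one']
  refine RunPrm.inCore_succ_of_landing (yPrmX_ok hn hv hlay R' q N) ht' ?_ ?_ hpiece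
  · rw [← mul_sub]; exact halong.1
  · rw [← mul_sub]; exact halong.2

end YBand

end Skelφ

end Summit.CriticalPhenomena.PercolationContinuityZ3.Theorems.Transplant

end
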